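import Literature.IUT.HodgeTheaters.ThetaGeometryInhabited
import Literature.IUT.HodgeTheaters.PuncturedEllipticArrowModelLift
import HarnessLib

/-!
# The finite model of [IUTchI] §1, part 7: ALL §1 claims over `Γ × (N ⋊ D_l)`, and a `ThetaGeometry` at which they fire

Mochizuki, *Inter-universal Teichmüller theory I*, kurims manuscript (May 2020), §1 pp. 37–40 and Def. 3.1
(b)(d)(f) pp. 61–63 ([IUTchI] §1 p.38) [claim: Mochizuki2012, status: disputed] (D-0012 claim key; series
status DISPUTED — WITNESS-class module; a MODEL of the interfaces, nothing of the series is asserted, no side is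
taken on [IUTchIII] Cor. 3.12).

CLOSES the witness gap NV-1 of abc-iut-L5-t8 g4 at the level of abc-iut-L5-t2's `ThetaGeometry`: for every compact
totally disconnected group `G_F`, closed subgroup `G_K`, and `l ≥ 5` prime to `6`,
* `pedOf G_K l` (part 6: `Π_{C_K} := G_K × (N ⋊ D_l)`) satisfies `ArrowCoveringClaims` (F-2586), `Rmk121`,
  `ArrowOpenClaims`, carries a `CuspGalois` (`liftCuspGalois`), and meets the Def. 3.1 (d) numerics — the §1
  construction is COMPUTED: `jKer = {1} × K`, `Π_{X̲→_K} = G_K × K`, `Π_{C̲→_K} = G_K × K′`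
  (transport of parts 3–5 along `liftSub = G_K × (−)`, `botSub = {1} × (−)`);
* `ArrowModel.geometryOf G_K l` : `ThetaGeometry G_F G_K l` with `pe := pedOf G_K l` (abc-iut-S2's
  `ThetaGeometryModel.geometryOf` with the abelian factor `ℤ/2 × ℤ/l` — at which the claims FAIL — replaced by
  `N ⋊ D_l`), hence `exists_thetaGeometry_arrowCoveringClaims` and, over a Galois tower `F ⊆ K ⊆ F̄`,
  `exists_thetaGeometry_galois_arrowCoveringClaims : ∃ geom : ThetaGeometry (F̄ ≃ₐ[F] F̄) (galoisSubgroupOf F K F̄) l,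
  geom.pe.ArrowCoveringClaims ∧ geom.pe.Rmk121 ∧ geom.pe.ArrowOpenClaims ∧ Nonempty geom.pe.CuspGalois`.
So the hypothesis `hA : pe.ArrowCoveringClaims` of the D13 (β)-input chain (abc-iut-L5-t4 p423760 / t13) has an
inhabitant built from a `ThetaGeometry` (universe `0`).  No `sorry`, no instance declared, symbolic `l`.
-/

namespace Literature.IUT.HodgeTheaters

namespace PuncturedEllipticData

namespace ArrowModel

open Literature.AnabelianGeometry.AbsoluteAnabelian DihedralGroup
open scoped Pointwise

/-! ### The §1 construction computed in `Γ × Φ` -/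

section Claims

variable (Γ : Type) [Group Γ] [TopologicalSpace Γ] [IsTopologicalGroup Γ] [CompactSpace Γ]
  [TotallyDisconnectedSpace Γ] (l : ℕ) [NeZero l] (h5 : 5 ≤ l) (h6 : Nat.Coprime l 6)

/-- `Π_X̲ = Γ × N`. [claim: Mochizuki2012, status: disputed] -/
theorem pedOf_piXbar : (pedOf Γ l h5 h6).PiXbar = liftSub Γ l (Nhat l) := by
  show (liftSub Γ l (PiXm l) ⊓ liftSub Γ l (PiCbarm l) : Subgroup (Γ × G l)) = _
  rw [← liftSub_inf, PiXm_inf_PiCbarm]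

/-- `Δ_C = {1} × Φ`. [claim: Mochizuki2012, status: disputed] -/
theorem pedOf_deltaC : (pedOf Γ l h5 h6).DeltaC = botSub Γ l ⊤ := geom_extOf Γ l

/-- `Δ_X̲ = {1} × N`. [claim: Mochizuki2012, status: disputed] -/
theorem pedOf_deltaXbar : (pedOf Γ l h5 h6).DeltaXbar = botSub Γ l (Nhat l) := by
  show (pedOf Γ l h5 h6).PiXbar ⊓ (pedOf Γ l h5 h6).DeltaC = _
  rw [pedOf_piXbar, pedOf_deltaC]
  show (liftSub Γ l (Nhat l) ⊓ botSub Γ l ⊤ : Subgroup (Γ × G l)) = _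
  rw [liftSub_inf_botSub, inf_top_eq]

/-- `Δ_C̲ = {1} × Φ_C̲`. [claim: Mochizuki2012, status: disputed] -/
theorem pedOf_deltaCbar : (pedOf Γ l h5 h6).DeltaCbar = botSub Γ l (PiCbarm l) := by
  show (pedOf Γ l h5 h6).PiCbar ⊓ (pedOf Γ l h5 h6).DeltaC = _
  rw [pedOf_deltaC]
  show (liftSub Γ l (PiCbarm l) ⊓ botSub Γ l ⊤ : Subgroup (Γ × G l)) = _
  rw [liftSub_inf_botSub, inf_top_eq]

/-- `I_x = {1} × D_x`. [claim: Mochizuki2012, status: disputed] -/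
theorem pedOf_inertia (x : ZMod l) : (pedOf Γ l h5 h6).inertia x = botSub Γ l (Dm l x) := by
  show (pedOf Γ l h5 h6).decomp x ⊓ (pedOf Γ l h5 h6).DeltaC = _
  rw [pedOf_deltaC]
  show (liftSub Γ l (Dm l x) ⊓ botSub Γ l ⊤ : Subgroup (Γ × G l)) = _
  rw [liftSub_inf_botSub, inf_top_eq]

omit [TopologicalSpace Γ] [IsTopologicalGroup Γ] [CompactSpace Γ] [TotallyDisconnectedSpace Γ] [NeZero l] in
/-- `{1} × N` is abelian. [claim: Mochizuki2012, status: disputed] -/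
theorem commutator_botSub_Nhat : ⁅botSub Γ l (Nhat l), botSub Γ l (Nhat l)⁆ = ⊥ := by
  rw [Subgroup.commutator_eq_bot_iff_le_centralizer]
  intro g hg
  rw [Subgroup.mem_centralizer_iff]
  intro h hh
  obtain ⟨hg1, hg2⟩ := mem_botSub.mp hg
  obtain ⟨hh1, hh2⟩ := mem_botSub.mp hh
  have hc : h.2 * g.2 = g.2 * h.2 := by
    have := Subgroup.mem_centralizer_iff.mp
      ((Subgroup.commutator_eq_bot_iff_le_centralizer.mp (commutator_Nhat_eq_bot l)) hg2) h.2 hh2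
    exact this
  refine Prod.ext ?_ ?_
  · rw [Prod.fst_mul, Prod.fst_mul, hg1, hh1]
  · rw [Prod.snd_mul, Prod.snd_mul, hc]

omit [TopologicalSpace Γ] [IsTopologicalGroup Γ] [CompactSpace Γ] [TotallyDisconnectedSpace Γ] [NeZero l] in
/-- `{1} × N` has exponent `l`. [claim: Mochizuki2012, status: disputed] -/
theorem closure_pow_botSub_Nhat :
    Subgroup.closure ((fun y : Γ × G l => y ^ l) '' (botSub Γ l (Nhat l) : Set (Γ × G l))) = ⊥ := by
  rw [Subgroup.closure_eq_bot_iff]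
  rintro y ⟨g, hg, rfl⟩
  obtain ⟨hg1, hg2⟩ := mem_botSub.mp hg
  rw [Set.mem_singleton_iff]
  show g ^ l = 1
  have h2 : g.2 ^ l = 1 := by
    have := (Subgroup.closure_eq_bot_iff.mp (closure_pow_Nhat_eq_bot l)) ⟨g.2, hg2, rfl⟩
    exact this
  refine Prod.ext ?_ ?_
  · rw [Prod.pow_fst, hg1, one_pow, Prod.fst_one]
  · rw [Prod.pow_snd, h2, Prod.snd_one]

/-- `modLKer = 1`. ([IUTchI] §1 p.37) [claim: Mochizuki2012, status: disputed] -/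
theorem pedOf_modLKer : (pedOf Γ l h5 h6).modLKer = ⊥ := by
  letI : TopologicalSpace (G l) := ⊥
  haveI : DiscreteTopology (G l) := ⟨rfl⟩
  refine le_antisymm ?_ bot_le
  unfold PuncturedEllipticData.modLKer
  refine Subgroup.topologicalClosure_minimal _ (sup_le ?_ ?_) ?_
  · rw [pedOf_deltaXbar]
    exact le_of_eq (commutator_botSub_Nhat Γ l)
  · rw [pedOf_deltaXbar]
    exact le_of_eq (closure_pow_botSub_Nhat Γ l)
  · -- `{1} = (Γ × {1}) ∩ ({1} × Φ)` is closed (no separation axiom on `Γ` needed)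
    show IsClosed (((⊥ : Subgroup (Γ × G l)) : Set (Γ × G l)))
    have e : (⊥ : Subgroup (Γ × G l)) = liftSub Γ l ⊥ ⊓ botSub Γ l ⊤ := by
      rw [liftSub_inf_botSub, bot_inf_eq, botSub, Subgroup.map_bot]
    rw [e, Subgroup.coe_inf, ← geom_extOf]
    exact (isClosed_liftSub Γ l ⊥).inter (extOf Γ l).isClosed_geom

/-- `deltaEpsKer = {1} × ⨆_{x ∉ {0,±1}} D_x`. ([IUTchI] §1 p.37) [claim: Mochizuki2012, status: disputed] -/
theorem pedOf_deltaEpsKer : (pedOf Γ l h5 h6).deltaEpsKer = botSub Γ l (EpsSup l) := by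
  show (pedOf Γ l h5 h6).modLKer ⊔ (⨆ x : {x : ZMod l // x ≠ 0 ∧ x ≠ 1 ∧ x ≠ -1},
    (pedOf Γ l h5 h6).inertia x.1) = _
  rw [pedOf_modLKer, bot_sup_eq, EpsSup, botSub_iSup]
  exact iSup_congr fun x => pedOf_inertia Γ l h5 h6 x.1

omit [TopologicalSpace Γ] [IsTopologicalGroup Γ] [CompactSpace Γ] [TotallyDisconnectedSpace Γ] [NeZero l] in
/-- The commutator set of the §1 construction in `Γ × Φ` is `(1, commSet)`. [claim: Mochizuki2012, status: disputed] -/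
theorem commSet_lift :
    {z : Γ × G l | ∃ x ∈ botSub Γ l (Nhat l), ∃ c ∈ botSub Γ l (PiCbarm l),
      c ∉ botSub Γ l (Nhat l) ∧ z = x * c * x⁻¹ * c⁻¹} = (MonoidHom.inr Γ (G l)) '' commSet l := by
  ext z
  constructor
  · rintro ⟨x, hx, c, hc, hcN, rfl⟩
    obtain ⟨hx1, hx2⟩ := mem_botSub.mp hx
    obtain ⟨hc1, hc2⟩ := mem_botSub.mp hc
    refine ⟨x.2 * c.2 * x.2⁻¹ * c.2⁻¹,
      ⟨x.2, hx2, c.2, hc2, fun h => hcN (mem_botSub.mpr ⟨hc1, h⟩), rfl⟩, Prod.ext ?_ rfl⟩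
    simp [hx1, hc1]
  · rintro ⟨w, ⟨x, hx, c, hc, hcN, rfl⟩, rfl⟩
    refine ⟨((1 : Γ), x), mem_botSub.mpr ⟨rfl, hx⟩, ((1 : Γ), c), mem_botSub.mpr ⟨rfl, hc⟩,
      fun h => hcN (mem_botSub.mp h).2, Prod.ext ?_ rfl⟩
    simp

/-- **`jKer = {1} × K`**. ([IUTchI] §1 p.38) [claim: Mochizuki2012, status: disputed] -/
theorem pedOf_jKer : (pedOf Γ l h5 h6).jKer = botSub Γ l (Khat l) := by
  obtain ⟨q, hq⟩ := Nat.coprime_two_right.mp (Nat.Coprime.coprime_dvd_right (show 2 ∣ 6 by norm_num) h6)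
  show (pedOf Γ l h5 h6).deltaEpsKer ⊔ Subgroup.closure {z | ∃ x ∈ (pedOf Γ l h5 h6).DeltaXbar,
    ∃ c ∈ (pedOf Γ l h5 h6).DeltaCbar, c ∉ (pedOf Γ l h5 h6).DeltaXbar ∧ z = x * c * x⁻¹ * c⁻¹} = _
  rw [pedOf_deltaEpsKer, pedOf_deltaXbar, pedOf_deltaCbar]
  show (botSub Γ l (EpsSup l) ⊔ Subgroup.closure {z : Γ × G l | ∃ x ∈ botSub Γ l (Nhat l),
    ∃ c ∈ botSub Γ l (PiCbarm l), c ∉ botSub Γ l (Nhat l) ∧ z = x * c * x⁻¹ * c⁻¹} : Subgroup (Γ × G l)) = _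
  rw [commSet_lift, ← botSub_closure, ← botSub_sup, sup_closure_commSet_eq_Khat l hq (by omega)]

/-- **`Π_{X̲→} = Γ × K`**. ([IUTchI] §1 p.38) [claim: Mochizuki2012, status: disputed] -/
theorem pedOf_piXarrow : (pedOf Γ l h5 h6).piXarrow = liftSub Γ l (Khat l) := by
  show (pedOf Γ l h5 h6).decomp (pedOf Γ l h5 h6).twoε ⊔ (pedOf Γ l h5 h6).jKer = _
  rw [pedOf_jKer]
  show (liftSub Γ l (Dm l 2) ⊔ botSub Γ l (Khat l) : Subgroup (Γ × G l)) = _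
  rw [liftSub_sup_botSub, sup_eq_right.mpr (Dm_le_Khat l (cusp_facts_of_five_le l h5).2.2.2.1
    (cusp_facts_of_five_le l h5).2.2.2.2.1 (cusp_facts_of_five_le l h5).2.2.2.2.2)]

omit [TopologicalSpace Γ] [IsTopologicalGroup Γ] [CompactSpace Γ] [TotallyDisconnectedSpace Γ] [NeZero l] in
/-- The `l`-th powers of `{1} × Φ_C̲` are `(1, powSet)`. [claim: Mochizuki2012, status: disputed] -/
theorem powSet_lift : (fun y : Γ × G l => y ^ l) '' (botSub Γ l (PiCbarm l) : Set (Γ × G l)) =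
    (MonoidHom.inr Γ (G l)) '' powSet l := by
  ext z
  constructor
  · rintro ⟨y, hy, rfl⟩
    obtain ⟨hy1, hy2⟩ := mem_botSub.mp hy
    refine ⟨y.2 ^ l, ⟨y.2, hy2, rfl⟩, Prod.ext ?_ ?_⟩
    · rw [MonoidHom.inr_apply]
      show (1 : Γ) = (y ^ l).1
      rw [Prod.pow_fst, hy1, one_pow]
    · rw [MonoidHom.inr_apply]
      show y.2 ^ l = (y ^ l).2
      rw [Prod.pow_snd]
  · rintro ⟨w, ⟨c, hc, rfl⟩, rfl⟩
    refine ⟨((1 : Γ), c), mem_botSub.mpr ⟨rfl, hc⟩, Prod.ext ?_ ?_⟩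
    · show (((1 : Γ), c) ^ l).1 = 1
      rw [Prod.pow_fst, one_pow]
    · show (((1 : Γ), c) ^ l).2 = c ^ l
      rw [Prod.pow_snd]

/-- **`galKer = {1} × K′`**. ([IUTchI] §1 p.38) [claim: Mochizuki2012, status: disputed] -/
theorem pedOf_galKer : (pedOf Γ l h5 h6).galKer = botSub Γ l (Khat' l) := by
  obtain ⟨q, hq⟩ := Nat.coprime_two_right.mp (Nat.Coprime.coprime_dvd_right (show 2 ∣ 6 by norm_num) h6)
  show (pedOf Γ l h5 h6).jKer ⊔ Subgroup.closure
    ((fun y : (pedOf Γ l h5 h6).PiC => y ^ l) '' ((pedOf Γ l h5 h6).DeltaCbar : Set _)) = _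
  rw [pedOf_jKer, pedOf_deltaCbar]
  show (botSub Γ l (Khat l) ⊔ Subgroup.closure
    ((fun y : Γ × G l => y ^ l) '' (botSub Γ l (PiCbarm l) : Set (Γ × G l))) : Subgroup (Γ × G l)) = _
  rw [powSet_lift, ← botSub_closure, ← botSub_sup, Khat_sup_closure_powSet_eq l hq]

/-- **`Π_{C̲→} = Γ × K′`**. ([IUTchI] §1 p.38) [claim: Mochizuki2012, status: disputed] -/
theorem pedOf_piCarrow : (pedOf Γ l h5 h6).piCarrow = liftSub Γ l (Khat' l) := by
  show (pedOf Γ l h5 h6).decomp (pedOf Γ l h5 h6).twoε ⊔ (pedOf Γ l h5 h6).galKer = _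
  rw [pedOf_galKer]
  show (liftSub Γ l (Dm l 2) ⊔ botSub Γ l (Khat' l) : Subgroup (Γ × G l)) = _
  rw [liftSub_sup_botSub, sup_eq_right.mpr ((Dm_le_Khat l (cusp_facts_of_five_le l h5).2.2.2.1
    (cusp_facts_of_five_le l h5).2.2.2.2.1 (cusp_facts_of_five_le l h5).2.2.2.2.2).trans (Khat_le_Khat' l))]

/-! ### ALL the §1 claims hold for `pedOf Γ l` -/

/-- **`ArrowCoveringClaims` for `pedOf Γ l`** (F-2586, all clauses). ([IUTchI] §1 p.38) [claim: Mochizuki2012, status: disputed] -/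
theorem pedOf_arrowCoveringClaims : (pedOf Γ l h5 h6).ArrowCoveringClaims := by
  have h2 : 2 ≤ l := by omega
  have h3 : 3 ≤ l := by omega
  have hodd : Odd l := Nat.coprime_two_right.mp (Nat.Coprime.coprime_dvd_right (show 2 ∣ 6 by norm_num) h6)
  have cycX : ∀ P : Subgroup (Γ × G l), P = liftSub Γ l (Khat l) →
      ∀ [(P.subgroupOf (liftSub Γ l (PiCbarm l))).Normal],
        IsCyclic (liftSub Γ l (PiCbarm l) ⧸ P.subgroupOf (liftSub Γ l (PiCbarm l))) := by
    rintro P rfl _; exact isCyclic_quot_liftSub Γ l (isCyclic_quot_Khat l h2 hodd)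
  have cycC : ∀ P : Subgroup (Γ × G l), P = liftSub Γ l (Khat' l) →
      ∀ [(P.subgroupOf (liftSub Γ l (PiCbarm l))).Normal],
        IsCyclic (liftSub Γ l (PiCbarm l) ⧸ P.subgroupOf (liftSub Γ l (PiCbarm l))) := by
    rintro P rfl _; exact isCyclic_quot_liftSub Γ l (isCyclic_quot_Khat' l h2)
  exact
  { jKer_normal := by
      rw [pedOf_jKer]
      exact normal_botSub_subgroupOf_liftSub Γ l ((Khat_le_Nhat l).trans (Nhat_le_PiCbarm l))
        (normal_Khat_subgroupOf_PiCbarm l)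
    jKer_relindex := by
      rw [pedOf_jKer, pedOf_deltaXbar]
      exact (botSub_relIndex Γ l _ _).trans (relIndex_Khat_Nhat l h2)
    inertia_ε1_sup := by
      rw [pedOf_inertia, pedOf_jKer, pedOf_deltaXbar]
      show (botSub Γ l (Dm l 1) ⊔ botSub Γ l (Khat l) : Subgroup (Γ × G l)) = _
      rw [← botSub_sup, Dm_one_sup_Khat l h3]
    inertia_ε2_sup := by
      rw [pedOf_inertia, pedOf_jKer, pedOf_deltaXbar]
      show (botSub Γ l (Dm l (-1)) ⊔ botSub Γ l (Khat l) : Subgroup (Γ × G l)) = _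
      rw [← botSub_sup, Dm_neg_one_sup_Khat l h3]
    piXarrow_inf_delta := by
      rw [pedOf_piXarrow, pedOf_deltaC, pedOf_jKer]
      show (liftSub Γ l (Khat l) ⊓ botSub Γ l ⊤ : Subgroup (Γ × G l)) = _
      rw [liftSub_inf_botSub, inf_top_eq]
    aug_piXarrow := by
      intro γ
      have hm : ((γ, 1) : (pedOf Γ l h5 h6).PiC) ∈ (pedOf Γ l h5 h6).piXarrow := by
        rw [pedOf_piXarrow]; exact (Khat l).one_mem
      exact ⟨⟨(γ, 1), hm⟩, rfl⟩
    cartesian := by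
      rw [pedOf_piXarrow, pedOf_piXbar, pedOf_piCarrow]
      show (liftSub Γ l (Khat l) : Subgroup (Γ × G l)) = liftSub Γ l (Nhat l) ⊓ liftSub Γ l (Khat' l)
      rw [← liftSub_inf, Nhat_inf_Khat']
    piXarrow_normal := by
      rw [pedOf_piXarrow]; exact normal_subgroupOf_liftSub Γ l (normal_Khat_subgroupOf_PiCbarm l)
    piCarrow_normal := by
      rw [pedOf_piCarrow]; exact normal_subgroupOf_liftSub Γ l (normal_Khat'_subgroupOf_PiCbarm l)
    piXarrow_relindex := by
      rw [pedOf_piXarrow]; exact (liftSub_relIndex Γ l _ _).trans (relIndex_Khat_PiCbarm l h2)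
    piCarrow_relindex := by
      rw [pedOf_piCarrow]; exact (liftSub_relIndex Γ l _ _).trans (relIndex_Khat'_PiCbarm l h2)
    galX_cyclic := @cycX _ (pedOf_piXarrow Γ l h5 h6)
    galC_cyclic := @cycC _ (pedOf_piCarrow Γ l h5 h6) }

/-- **Remark 1.2.1 for `pedOf Γ l`**: normalisers `= Π_C̲`, orders `2l`, `l`. ([IUTchI] Rmk 1.2.1 p.40)
[claim: Mochizuki2012, status: disputed] -/
theorem pedOf_rmk121 : (pedOf Γ l h5 h6).Rmk121 := by
  have h2 : 2 ≤ l := by omega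
  have h3 : 3 ≤ l := by omega
  exact
  { normalizer_piXarrow := by
      rw [pedOf_piXarrow]
      show Subgroup.normalizer (liftSub Γ l (Khat l) : Set (Γ × G l)) = liftSub Γ l (PiCbarm l)
      rw [normalizer_liftSub, normalizer_Khat l h3]
    normalizer_piCarrow := by
      rw [pedOf_piCarrow]
      show Subgroup.normalizer (liftSub Γ l (Khat' l) : Set (Γ × G l)) = liftSub Γ l (PiCbarm l)
      rw [normalizer_liftSub, normalizer_Khat' l h3]
    card_galX := by
      rw [pedOf_piXarrow]; exact (liftSub_relIndex Γ l _ _).trans (relIndex_Khat_PiCbarm l h2)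
    card_galC := by
      rw [pedOf_piCarrow]; exact (liftSub_relIndex Γ l _ _).trans (relIndex_Khat'_PiCbarm l h2) }

/-- `ArrowOpenClaims` for `pedOf Γ l` (`Γ × K`, `Γ × K′` are open). ([IUTchI] §1 p.38) [claim: Mochizuki2012, status: disputed] -/
theorem pedOf_arrowOpenClaims : (pedOf Γ l h5 h6).ArrowOpenClaims := by
  refine ⟨?_, ?_⟩
  · rw [pedOf_piXarrow]; exact isOpen_liftSub Γ l (Khat l)
  · rw [pedOf_piCarrow]; exact isOpen_liftSub Γ l (Khat' l)

/-- The Def. 3.1 (d) numerics for `pedOf Γ l`. ([IUTchI] Def 3.1(d) p.62) [claim: Mochizuki2012, status: disputed] -/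
theorem pedOf_numerics :
    (pedOf Γ l h5 h6).PiXbar.relIndex (pedOf Γ l h5 h6).PiX = l ∧
      (pedOf Γ l h5 h6).PiXbar.relIndex (pedOf Γ l h5 h6).PiCbar = 2 ∧
      ¬ (pedOf Γ l h5 h6).PiCbar ≤ (pedOf Γ l h5 h6).PiX ∧
      Function.Surjective ((pedOf Γ l h5 h6).E.aug.toMonoidHom.comp (pedOf Γ l h5 h6).PiXbar.subtype) := by
  refine ⟨?_, ?_, ?_, ?_⟩
  · rw [pedOf_piXbar]; exact (liftSub_relIndex Γ l _ _).trans (relIndex_Nhat_PiXm l)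
  · rw [pedOf_piXbar]; exact (liftSub_relIndex Γ l _ _).trans (relIndex_Nhat_PiCbarm l)
  · intro h
    have : ((1 : Γ), sigmaHat l) ∈ liftSub Γ l (PiXm l) :=
      h (show ((1 : Γ), sigmaHat l) ∈ liftSub Γ l (PiCbarm l) from sigmaHat_mem_PiCbarm l)
    exact sigmaHat_not_mem_PiXm l this
  · intro γ
    have hm : ((γ, 1) : (pedOf Γ l h5 h6).PiC) ∈ (pedOf Γ l h5 h6).PiXbar := by
      rw [pedOf_piXbar]; exact (Nhat l).one_mem
    exact ⟨⟨(γ, 1), hm⟩, rfl⟩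

end Claims

/-! ### A `ThetaGeometry` at which the §1 claims fire -/

section Theta

variable {GF : Type} [Group GF] [TopologicalSpace GF] [IsTopologicalGroup GF] [CompactSpace GF]
  [TotallyDisconnectedSpace GF] (GK : Subgroup GF) (l : ℕ) [NeZero l]

/-- **A `ThetaGeometry G_F G_K l` whose `pe` is `pedOf G_K l`** (abc-iut-S2's construction with the factor
`ℤ/2 × ℤ/l` replaced by `N ⋊ D_l`): `Π_{C_F} := G_F × Φ`, `Π_{X_F} := G_F × Φ_X`, the `K`-level data embedded by
the inclusion. ([IUTchI] Def 3.1(d) p.62) [claim: Mochizuki2012, status: disputed] -/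
noncomputable def geometryOf (hGK : IsClosed (GK : Set GF)) (h5 : 5 ≤ l) (h6 : l.Coprime 6) :
    ThetaGeometry GF GK l :=
  letI : CompactSpace GK := isCompact_iff_compactSpace.mp hGK.isCompact
  letI : TopologicalSpace (G l) := ⊥
  haveI : DiscreteTopology (G l) := ⟨rfl⟩
  { extF := extOf GF l
    galIso := MulEquiv.refl GF
    galIso_continuous := ⟨continuous_id, continuous_id⟩
    PiX := liftSub GF l (PiXm l)
    PiX_isOpen := isOpen_liftSub GF l (PiXm l)
    PiX_normal := (Subgroup.normal_of_index_eq_two (index_PiXm l)).comap _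
    PiX_index := (liftSub_index GF l (PiXm l)).trans (index_PiXm l)
    aug_PiX := by
      rw [eq_top_iff]
      intro g _
      exact ⟨(g, 1), (PiXm l).one_mem, rfl⟩
    pe := pedOf GK l h5 h6
    pe_l := rfl
    embK := MonoidHom.prodMap GK.subtype (MonoidHom.id (G l))
    embK_continuous := continuous_subtype_val.prodMap continuous_id
    embK_injective := by
      rintro ⟨a, b⟩ ⟨c, d⟩ h
      have h1 := congrArg Prod.fst h
      have h2 := congrArg Prod.snd h
      exact Prod.ext (Subtype.ext h1) h2
    embK_range := by
      ext x
      constructor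
      · rintro ⟨y, rfl⟩
        exact y.1.property
      · intro hx
        have hx' : x.1 ∈ GK := hx
        exact ⟨(⟨x.1, hx'⟩, x.2), Prod.ext rfl rfl⟩
    galKIso := MulEquiv.refl GK
    aug_compat := fun _ => rfl
    embK_PiX := by
      ext x
      constructor
      · rintro ⟨y, hmem, rfl⟩
        exact ⟨hmem, y, rfl⟩
      · rintro ⟨hmem, y, hy⟩
        have h2 : y.2 = x.2 := congrArg Prod.snd hy
        have hmem' : x.2 ∈ PiXm l := hmem
        refine ⟨y, ?_, hy⟩
        show y.2 ∈ PiXm l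
        rw [h2]
        exact hmem'
    PiXbar_relIndex := (pedOf_numerics GK l h5 h6).1
    aug_PiXbar := (pedOf_numerics GK l h5 h6).2.2.2
    PiXbar_relIndex_PiCbar := (pedOf_numerics GK l h5 h6).2.1
    not_PiCbar_le_PiX := (pedOf_numerics GK l h5 h6).2.2.1 }

/-- **A `ThetaGeometry` at which ALL the §1 claims fire** (NV-1 closed at the `ThetaGeometry` level): for every
compact totally disconnected group `G_F`, closed `G_K ⊆ G_F`, `l ≥ 5` prime to `6`.
([IUTchI] §1 p.38) [claim: Mochizuki2012, status: disputed] -/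
theorem exists_thetaGeometry_arrowCoveringClaims (hGK : IsClosed (GK : Set GF)) (h5 : 5 ≤ l)
    (h6 : l.Coprime 6) :
    ∃ geom : ThetaGeometry GF GK l, geom.pe.ArrowCoveringClaims ∧ geom.pe.Rmk121 ∧
      geom.pe.ArrowOpenClaims ∧ Nonempty geom.pe.CuspGalois := by
  letI : CompactSpace GK := isCompact_iff_compactSpace.mp hGK.isCompact
  exact ⟨geometryOf GK l hGK h5 h6, pedOf_arrowCoveringClaims GK l h5 h6, pedOf_rmk121 GK l h5 h6,
    pedOf_arrowOpenClaims GK l h5 h6, ⟨liftCuspGalois GK l h5 h6⟩⟩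

end Theta

/-- **Over a Galois tower `F ⊆ K ⊆ F̄`**: a `ThetaGeometry (F̄ ≃ₐ[F] F̄) (galoisSubgroupOf F K F̄) l` at which
`ArrowCoveringClaims`, `Rmk121`, `ArrowOpenClaims` hold and `CuspGalois` is inhabited — the hypothesis `hA` of
the D13 (β)-input chain fires at a `ThetaGeometry` built over genuine absolute Galois groups.
([IUTchI] Def 3.1(d) p.62) [claim: Mochizuki2012, status: disputed] -/
theorem exists_thetaGeometry_galois_arrowCoveringClaims {F Fbar : Type} [Field F] [Field Fbar]
    [Algebra F Fbar] (K : Type) [Field K] [Algebra F K] [Algebra K Fbar] [IsScalarTower F K Fbar]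
    [IsGalois F Fbar] {l : ℕ} (h5 : 5 ≤ l) (h6 : l.Coprime 6) :
    ∃ geom : ThetaGeometry (Fbar ≃ₐ[F] Fbar) (galoisSubgroupOf F K Fbar) l,
      geom.pe.ArrowCoveringClaims ∧ geom.pe.Rmk121 ∧ geom.pe.ArrowOpenClaims ∧ Nonempty geom.pe.CuspGalois :=
  haveI : NeZero l := ⟨by omega⟩
  exists_thetaGeometry_arrowCoveringClaims _ l (ThetaGeometryModel.isClosed_galoisSubgroupOf F K Fbar) h5 h6

end ArrowModel

end PuncturedEllipticData

end Literature.IUT.HodgeTheaters
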